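import Mathlib

/-!
# p4 g23 — the log-free residual (J′) and (BANK\*) with `C = 0`: the assembly, kernel-checked

Crux workfile for `stmt-PneNP-18538` (`KrwChromaticSteering.StrongComposition`, C1), companion of the memo
`Cruxes/StrongComposition/LensBarrierP4g23.md`.  FRONTIER bookkeeping for the t-free LRA rung; nothing here bears on P vs NP.

The exact books (`BankScriptsP4g22.md`, `bank3.Books`) attach to every reachable state: the alive rows `A`, the declared
alive rows `Decl ⊆ A` (one per CLOSE of an alive row, never killed), the undeclared alive rows `UA = A \ Decl`, depths
`d_a` (load `dim π_a W` for `a ∈ UA`, pinned dimension for `a ∈ Decl`), kills `K`, bits `B`, closes `c`, and the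
2-retired depth `D = min_{S ⊊ A} (2|S| + max_{A∖S} d)` (`D = −1 − M*` of `NextRungP4g22`).

The memo proves, in the model, for every event sequence and every prefix:

* (J′)  `2K + D ≤ B + 2c`   — hence  (Klin) `K + D ≤ #events`  and  (BANK\*)₀ `Σ hcost + D ≤ #events`.

from four one-step facts about linear algebra (Lemmas A–D of the memo).  THIS FILE kernel-checks the whole argument for
an abstract model of the books: §1–§3 the assembly (retiring declared rows, the `UA = ∅` endgame, the induction along a
trajectory with one-step hypotheses (A)–(D)); §4 the linear algebra of the one-step Lemmas A, B, D over any field; §5 the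
books themselves as a nondeterministic machine on subspaces of `ι → M` (bits with kill sets inside the EQ-candidate set,
closures of any undeclared row — alive or dead — with kill sets inside the CLOSE-candidate set, never a clean sweep, and free
purges of dead rows' coordinates), the proof that every run of the machine is a `BooksTrace`, and hence (J′), (Klin), (BANK\*)₀
for every run (`BState.Run.jprime`, `.klin`, `.bankStar`, `.retiredFloorGe`).  The only thing left outside Lean is the dictionary
`bank3.Books` / `BooksP` → `BState.Step` (each transition of the Python books, in either semantics, is a `Step` or a `Step`
followed by purges; memo §6), which is by inspection of the definitions.

* §1 `TwoRetiredDepthLe A d y` («`D ≤ y`», depth form) and its equivalence with the credit form `RetiredFloorGe` of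
  `NextRungP4g22` (copied verbatim: that module is a workfile, not built on the farm).
* §2 single-state assembly: `depthLe_of_rowInvariant` (J′), `bankStar_of_rowInvariant` (BANK\*)₀, `klin_of_rowInvariant`.
* §3 `BooksTrace`: the abstract trajectory with one-step hypotheses; `rowInvariant`, `endgame`, `jprime`, `bankStar`, `klin`.
* §4 the linear algebra of Lemmas A, B, D over any field (`structure_step_fresh/bit/close/deadclose`, `factC1`,
  `exists_functional_of_linearIndependent`).
* §5 `BState`, `BState.Step` (`bit`, `close`, `purge`, `idle`), `BState.Run`: the machine; `Step.row_step` (Lemmas A+B one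
  step, four + one cases), `Step.last_row` and `Inv.alive_nonempty` (Lemma D's consequences), `Run.toTrace`, and the theorems
  `Run.jprime/klin/bankStar/retiredFloorGe` (v1.2: with purges, so that semantics S1 AND S2 of the memo are both instances).
-/

set_option linter.dupNamespace false
set_option linter.unusedSectionVars false

namespace Summit.PneNP.PneNP.Cruxes.StrongComposition.P4g23X

universe u

section Depth

variable {ρ : Type u} [DecidableEq ρ]

/-- `TwoRetiredDepthLe alive d y` : the 2-retired depth of the depth family `d` on the alive rows is `≤ y` — some set `S`
of alive rows, NOT all of them, can be retired at label cost `2` each so that every remaining alive row has depth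
`≤ y − 2|S|`.  (`D = min_S [max_{alive ∖ S} d + 2|S|]`.) -/
def TwoRetiredDepthLe (alive : Finset ρ) (d : ρ → ℕ) (y : ℤ) : Prop :=
  ∃ S : Finset ρ, S ⊆ alive ∧ S ≠ alive ∧ ∀ i ∈ alive \ S, (d i : ℤ) + 2 * (S.card : ℤ) ≤ y

/-- Verbatim copy of `P4g22X.RetiredFloorGe` (credit form, `M* ≥ x`). -/
def RetiredFloorGe (alive : Finset ρ) (cr : ρ → ℤ) (x : ℤ) : Prop :=
  ∃ S : Finset ρ, S ⊆ alive ∧ S ≠ alive ∧ ∀ i ∈ alive \ S, x + 2 * (S.card : ℤ) ≤ cr i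

omit [DecidableEq ρ] in
/-- credits are `−1 − depth`; `M* ≥ x ⟺ D ≤ −1 − x`. -/
theorem retiredFloorGe_iff_depthLe [DecidableEq ρ] (alive : Finset ρ) (d : ρ → ℕ) (x : ℤ) :
    RetiredFloorGe alive (fun i => -1 - (d i : ℤ)) x ↔ TwoRetiredDepthLe alive d (-1 - x) := by
  constructor
  · rintro ⟨S, hS, hne, h⟩
    refine ⟨S, hS, hne, fun i hi => ?_⟩
    have h' := h i hi
    dsimp only at h'
    linarith
  · rintro ⟨S, hS, hne, h⟩
    refine ⟨S, hS, hne, fun i hi => ?_⟩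
    have h' := h i hi
    dsimp only
    linarith

omit [DecidableEq ρ] in
theorem TwoRetiredDepthLe.mono [DecidableEq ρ] {alive : Finset ρ} {d : ρ → ℕ} {y y' : ℤ} (hy : y ≤ y')
    (h : TwoRetiredDepthLe alive d y) : TwoRetiredDepthLe alive d y' := by
  obtain ⟨S, hS, hne, h⟩ := h
  exact ⟨S, hS, hne, fun i hi => le_trans (h i hi) hy⟩

/-! ## §2 Single-state assembly -/

/-- (J′) from the per-row invariant.  Hypotheses: `decl ⊆ alive` are the declared alive rows, at most one per close
(`decl.card ≤ c`); (U) every undeclared alive row satisfies `2K + d_a ≤ B` (Lemma C of the memo with the structure term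
dropped); (E) if no undeclared alive row is left, some alive row still satisfies it (memo: the last row closed, by Lemma D).
Conclusion: `D ≤ B + 2c − 2K`.  The witness is explicit: retire the declared rows (resp. all rows but that one). -/
theorem depthLe_of_rowInvariant {alive decl : Finset ρ} (hsub : decl ⊆ alive)
    {d : ρ → ℕ} {K B c : ℕ} (hc : decl.card ≤ c)
    (hU : ∀ a ∈ alive \ decl, 2 * K + d a ≤ B)
    (hE : alive \ decl = ∅ → ∃ u ∈ alive, 2 * K + d u ≤ B) :
    TwoRetiredDepthLe alive d ((B : ℤ) + 2 * c - 2 * K) := by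
  by_cases h : alive \ decl = ∅
  · obtain ⟨u, hu, hKu⟩ := hE h
    have hAsub : alive ⊆ decl := by
      intro i hi
      by_contra hin
      have hi' : i ∈ alive \ decl := Finset.mem_sdiff.2 ⟨hi, hin⟩
      rw [h] at hi'
      simp at hi'
    have hcardA : alive.card ≤ c := le_trans (Finset.card_le_card hAsub) hc
    have hce : (alive.erase u).card + 1 = alive.card := Finset.card_erase_add_one hu
    refine ⟨alive.erase u, Finset.erase_subset _ _, ?_, fun i hi => ?_⟩
    · intro h0
      have hu' : u ∈ alive.erase u := by rw [h0]; exact hu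
      simp at hu'
    · have hi' := Finset.mem_sdiff.1 hi
      have hiu : i = u := by
        by_contra hne'
        exact hi'.2 (Finset.mem_erase.2 ⟨hne', hi'.1⟩)
      subst hiu
      omega
  · refine ⟨decl, hsub, ?_, fun i hi => ?_⟩
    · intro h0
      apply h
      rw [h0]
      simp
    · have := hU i hi
      omega

/-- (BANK\*) with `C = 0` from the same hypotheses plus `H ≤ K` (`hcost = 1 + ⌈log₂ k⌉ ≤ k` summed) and `d_a ≤ B`
(a depth is a number of fresh bits): `D ≤ B + c − H`, i.e. `H + D ≤ #events`. -/
theorem bankStar_of_rowInvariant {alive decl : Finset ρ} (hsub : decl ⊆ alive) (hne : alive.Nonempty)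
    {d : ρ → ℕ} {K B c H : ℕ} (hc : decl.card ≤ c) (hH : H ≤ K) (hdB : ∀ a ∈ alive, d a ≤ B)
    (hU : ∀ a ∈ alive \ decl, 2 * K + d a ≤ B)
    (hE : alive \ decl = ∅ → ∃ u ∈ alive, 2 * K + d u ≤ B) :
    TwoRetiredDepthLe alive d ((B : ℤ) + c - H) := by
  by_cases hKc : c ≤ K
  · obtain ⟨S, hS, hne', h⟩ := depthLe_of_rowInvariant hsub hc hU hE
    exact ⟨S, hS, hne', fun i hi => by have := h i hi; omega⟩
  · refine ⟨∅, Finset.empty_subset _, ?_, fun i hi => ?_⟩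
    · intro h0
      exact hne.ne_empty h0.symm
    · simp only [Finset.sdiff_empty] at hi
      have := hdB i hi
      simp only [Finset.card_empty, Nat.cast_zero, mul_zero, add_zero]
      omega

/-- Linear spend: `K + D ≤ #events`. -/
theorem klin_of_rowInvariant {alive decl : Finset ρ} (hsub : decl ⊆ alive) (hne : alive.Nonempty)
    {d : ρ → ℕ} {K B c : ℕ} (hc : decl.card ≤ c) (hdB : ∀ a ∈ alive, d a ≤ B)
    (hU : ∀ a ∈ alive \ decl, 2 * K + d a ≤ B)
    (hE : alive \ decl = ∅ → ∃ u ∈ alive, 2 * K + d u ≤ B) :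
    TwoRetiredDepthLe alive d ((B : ℤ) + c - K) :=
  bankStar_of_rowInvariant hsub hne hc le_rfl hdB hU hE

/-- The same in the credit form of `NextRungP4g22` (`Φ* = h − π + M* − Π*`): `M* ≥ H − #events − 1`. -/
theorem retiredFloorGe_of_rowInvariant {alive decl : Finset ρ} (hsub : decl ⊆ alive) (hne : alive.Nonempty)
    {d : ρ → ℕ} {K B c H : ℕ} (hc : decl.card ≤ c) (hH : H ≤ K) (hdB : ∀ a ∈ alive, d a ≤ B)
    (hU : ∀ a ∈ alive \ decl, 2 * K + d a ≤ B)
    (hE : alive \ decl = ∅ → ∃ u ∈ alive, 2 * K + d u ≤ B) :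
    RetiredFloorGe alive (fun i => -1 - (d i : ℤ)) ((H : ℤ) - (B + c) - 1) := by
  rw [retiredFloorGe_iff_depthLe]
  have h := bankStar_of_rowInvariant hsub hne hc hH hdB hU hE
  refine h.mono ?_
  omega

end Depth

/-! ## §3 Trajectories: the one-step hypotheses and the induction -/

section Trace

variable {ρ : Type u} [DecidableEq ρ]

/-- An abstract trajectory of the books.  Time `t : ℕ` counts events.  The data are the observables of the memo; the
hypotheses are exactly what Lemmas A–D of the memo establish for `bank3.Books` (and for the variant with dead rows
projected at once), with the linear algebra abstracted away:
* (A)+(B) `row_step` — for a row that is undeclared and alive after the step, the per-row potential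
  `2K + d_a + g_a − B` does not increase (a-fresh bit: `d_a+1, B+1`, no kill, `g_a` fixed; other bit: `g_a` rises by ≤ 1
  and every killed row removes ≥ 2 from it; a CLOSE with `κ` kills removes ≥ 2κ from it);
* (D) `last_row` — the undeclared alive rows can only run out by CLOSING the last one (a CLOSE kills at most
  `#candidates − 1` rows, an EQ bit at most `⌊|C|/2⌋ < |C|`), an event with no kill that keeps that row alive with its depth;
* `empty_step` — once no undeclared alive row is left there are no kills, alive rows stay alive, and a depth rises by at
  most the number of new bits;
* bookkeeping: `decl ⊆ alive`, at most one declared alive row per close, alive rows never run out (D), undeclared alive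
  rows are never created, depths are numbers of fresh bits (`d ≤ B`), `K`, `d`, `g` start at `0`. -/
structure BooksTrace (ρ : Type u) [DecidableEq ρ] where
  alive : ℕ → Finset ρ
  decl : ℕ → Finset ρ
  d : ℕ → ρ → ℕ
  g : ℕ → ρ → ℕ
  K : ℕ → ℕ
  B : ℕ → ℕ
  c : ℕ → ℕ
  decl_sub : ∀ t, decl t ⊆ alive t
  alive_nonempty : ∀ t, (alive t).Nonempty
  card_decl : ∀ t, (decl t).card ≤ c t
  depth_le_bits : ∀ t, ∀ a ∈ alive t, d t a ≤ B t
  init_K : K 0 = 0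
  init_d : ∀ a, d 0 a = 0
  init_g : ∀ a, g 0 a = 0
  undecl_anti : ∀ t, alive (t + 1) \ decl (t + 1) ⊆ alive t \ decl t
  decl_persist : ∀ t, decl t ⊆ decl (t + 1)
  row_step : ∀ t, ∀ a ∈ alive (t + 1) \ decl (t + 1),
    2 * K (t + 1) + d (t + 1) a + g (t + 1) a + B t ≤ 2 * K t + d t a + g t a + B (t + 1)
  last_row : ∀ t, alive (t + 1) \ decl (t + 1) = ∅ → (alive t \ decl t).Nonempty →
    ∃ u ∈ alive t \ decl t, u ∈ alive (t + 1) ∧ K (t + 1) = K t ∧ d (t + 1) u = d t u ∧ B t ≤ B (t + 1)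
  empty_step : ∀ t, alive t \ decl t = ∅ →
    K (t + 1) = K t ∧ B t ≤ B (t + 1) ∧ ∀ a ∈ alive (t + 1), d (t + 1) a + B t ≤ d t a + B (t + 1)

namespace BooksTrace

variable (T : BooksTrace ρ)

/-- Lemma C of the memo: the per-row invariant `2K + d_a + g_a ≤ B` for every undeclared alive row. -/
theorem rowInvariant : ∀ t, ∀ a ∈ T.alive t \ T.decl t, 2 * T.K t + T.d t a + T.g t a ≤ T.B t := by
  intro t
  induction t with
  | zero =>
    intro a _
    simp [T.init_K, T.init_d, T.init_g]
  | succ t ih =>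
    intro a ha
    have ha0 : a ∈ T.alive t \ T.decl t := T.undecl_anti t ha
    have h1 := T.row_step t a ha
    have h2 := ih a ha0
    omega

/-- The endgame invariant: when no undeclared alive row is left, some alive row `u` has `2K + d_u ≤ B`. -/
theorem endgame : ∀ t, T.alive t \ T.decl t = ∅ → ∃ u ∈ T.alive t, 2 * T.K t + T.d t u ≤ T.B t := by
  intro t
  induction t with
  | zero =>
    intro _
    obtain ⟨u, hu⟩ := T.alive_nonempty 0
    exact ⟨u, hu, by simp [T.init_K, T.init_d]⟩
  | succ t ih =>
    intro hemp
    by_cases h0 : T.alive t \ T.decl t = ∅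
    · obtain ⟨u, hu, hKu⟩ := ih h0
      have hudecl : u ∈ T.decl t := by
        by_contra hn
        have : u ∈ T.alive t \ T.decl t := Finset.mem_sdiff.2 ⟨hu, hn⟩
        rw [h0] at this
        simp at this
      have hu1 : u ∈ T.alive (t + 1) := T.decl_sub (t + 1) (T.decl_persist t hudecl)
      obtain ⟨hK, hB, hd⟩ := T.empty_step t h0
      have hdu := hd u hu1
      exact ⟨u, hu1, by omega⟩
    · have hne : (T.alive t \ T.decl t).Nonempty := Finset.nonempty_iff_ne_empty.2 h0
      obtain ⟨u, hu, hu1, hK, hd, hB⟩ := T.last_row t hemp hne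
      have hinv := T.rowInvariant t u hu
      exact ⟨u, hu1, by omega⟩

/-- (J′) along the trajectory: `D_t ≤ B_t + 2 c_t − 2 K_t`. -/
theorem jprime (t : ℕ) :
    TwoRetiredDepthLe (T.alive t) (T.d t) ((T.B t : ℤ) + 2 * T.c t - 2 * T.K t) :=
  depthLe_of_rowInvariant (T.decl_sub t) (T.card_decl t)
    (fun a ha => by have := T.rowInvariant t a ha; omega) (T.endgame t)

/-- (BANK\*) with `C = 0` along the trajectory, for any spend `H_t ≤ K_t`: `H_t + D_t ≤ B_t + c_t = #events`. -/
theorem bankStar (t : ℕ) {H : ℕ} (hH : H ≤ T.K t) :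
    TwoRetiredDepthLe (T.alive t) (T.d t) ((T.B t : ℤ) + T.c t - H) :=
  bankStar_of_rowInvariant (T.decl_sub t) (T.alive_nonempty t) (T.card_decl t) hH (T.depth_le_bits t)
    (fun a ha => by have := T.rowInvariant t a ha; omega) (T.endgame t)

/-- Linear spend: `K_t + D_t ≤ #events`. -/
theorem klin (t : ℕ) : TwoRetiredDepthLe (T.alive t) (T.d t) ((T.B t : ℤ) + T.c t - T.K t) :=
  T.bankStar t le_rfl

/-- Credit form for the lead's `Φ*`: `M*_t ≥ H_t − #events_t − 1`. -/
theorem retiredFloorGe (t : ℕ) {H : ℕ} (hH : H ≤ T.K t) :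
    RetiredFloorGe (T.alive t) (fun i => -1 - (T.d t i : ℤ)) ((H : ℤ) - (T.B t + T.c t) - 1) :=
  retiredFloorGe_of_rowInvariant (T.decl_sub t) (T.alive_nonempty t) (T.card_decl t) hH (T.depth_le_bits t)
    (fun a ha => by have := T.rowInvariant t a ha; omega) (T.endgame t)

end BooksTrace

end Trace

/-! ## §4 The linear algebra of Lemmas A, B, D (any field; rows `ι`, row space `M`, `V = ι → M`)

`killRows Z` is `π_{¬Z}` (zero the rows in `Z`), `rowSupp T` is `V_T`, `Submodule.map (LinearMap.proj a)` is `π_a`.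
Dictionary to the memo: load `d_a = finrank (map (proj a) W)`; `W̄ = map (killRows Dead) W`;
`ḡ_a = finrank (W̄ ⊓ rowSupp (UA \ {a}))`; pivot `f_j = finrank (W ⊓ rowSupp {j})`;
link + pivot `f_q + m_q = finrank (W ⊓ rowSupp {q, i₀}) − f_{i₀}` (FACT C1 below says these add up).
* Lemma A (i): `map_proj_sup_span`, `finrank_sup_span_of_not_mem`, `sup_span_of_mem`, `map_proj_map_killRows`.
* Lemma A (ii)/(iii) and B1: `sup_span_inf_rowSupp_of_fresh` (an `a`-fresh bit raises no `F_j`, `j ≠ a`, and no `ḡ_a`).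
* Lemma B2: `structure_step_bit` (from `finrank_sup_span_inf_le`, the projection formula `finrank_map_killRows_inf_add`
  and block independence `sum_finrank_inf_rowSupp_singleton_le`).
* Lemma B3: `structure_step_close` (alive pivot; uses `factC1`) and `structure_step_deadclose` (dead pivot).
* Lemma D core: `exists_functional_of_linearIndependent` (prescribed values on independent tags).
What is NOT here: the books themselves (which rows are candidates / killed is the dictionary's business, g22 §1) — the
hypotheses `hkill` (a killed row carries ≥ 2 pivot dimensions) and the reading of `f_q + m_q ≥ 2` are where they enter. -/

section LinAlg

open Module

variable {𝕜 : Type*} [Field 𝕜] {ι : Type*} [Fintype ι] [DecidableEq ι]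
  {M : Type*} [AddCommGroup M] [Module 𝕜 M] [FiniteDimensional 𝕜 M]

/-- `π_{¬Z}` : zero the coordinates (rows) in `Z`. -/
def killRows (Z : Finset ι) : (ι → M) →ₗ[𝕜] (ι → M) :=
  LinearMap.pi fun j => (if j ∈ Z then (0 : 𝕜) else 1) • (LinearMap.proj j : (ι → M) →ₗ[𝕜] M)

omit [Fintype ι] [FiniteDimensional 𝕜 M] in
@[simp] theorem killRows_apply (Z : Finset ι) (v : ι → M) (j : ι) :
    killRows (𝕜 := 𝕜) Z v j = if j ∈ Z then 0 else v j := by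
  simp only [killRows, LinearMap.pi_apply, LinearMap.smul_apply, LinearMap.proj_apply]
  split_ifs <;> simp

/-- `V_T` : the vectors supported on the rows `T` (all other coordinates zero). -/
def rowSupp (T : Finset ι) : Submodule 𝕜 (ι → M) := LinearMap.ker (killRows (𝕜 := 𝕜) (M := M) T)

omit [Fintype ι] [FiniteDimensional 𝕜 M] in
theorem mem_rowSupp {T : Finset ι} {v : ι → M} : v ∈ rowSupp (𝕜 := 𝕜) T ↔ ∀ j, j ∉ T → v j = 0 := by
  simp only [rowSupp, LinearMap.mem_ker, funext_iff, killRows_apply, Pi.zero_apply]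
  constructor
  · intro h j hj
    have := h j
    simpa [hj] using this
  · intro h j
    by_cases hj : j ∈ T
    · simp [hj]
    · simp [hj, h j hj]

omit [Fintype ι] [FiniteDimensional 𝕜 M] in
theorem rowSupp_mono {T T' : Finset ι} (h : T ⊆ T') : rowSupp (𝕜 := 𝕜) (M := M) T ≤ rowSupp T' := by
  intro v hv
  rw [mem_rowSupp] at hv ⊢
  exact fun j hj => hv j fun hjT => hj (h hjT)

/-- Lemma B (B1): a bit FRESH for row `a` (its `a`-component is not in `π_a X`) adds no structure off row `a`. -/
theorem sup_span_inf_rowSupp_of_fresh {X : Submodule 𝕜 (ι → M)} {x : ι → M} {a : ι} {T : Finset ι}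
    (ha : a ∉ T) (hfresh : x a ∉ Submodule.map (LinearMap.proj a : (ι → M) →ₗ[𝕜] M) X) :
    (X ⊔ 𝕜 ∙ x) ⊓ rowSupp T = X ⊓ rowSupp T := by
  apply le_antisymm
  · rintro y ⟨hy, hyT⟩
    rw [SetLike.mem_coe, Submodule.mem_sup] at hy
    obtain ⟨w, hw, z, hz, rfl⟩ := hy
    rw [Submodule.mem_span_singleton] at hz
    obtain ⟨c, rfl⟩ := hz
    have h0 : (w + c • x) a = 0 := (mem_rowSupp.1 hyT) a ha
    by_cases hc : c = 0
    · subst hc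
      simp only [zero_smul, add_zero] at hyT ⊢
      exact ⟨hw, hyT⟩
    · exfalso
      apply hfresh
      have h1 : c • x a = -(w a) := by
        have h0' : w a + c • x a = 0 := by simpa [Pi.add_apply, Pi.smul_apply] using h0
        exact eq_neg_of_add_eq_zero_right h0'
      refine ⟨-(c⁻¹ • w), X.neg_mem (X.smul_mem _ hw), ?_⟩
      rw [LinearMap.proj_apply, Pi.neg_apply, Pi.smul_apply, ← smul_neg, ← h1, smul_smul, inv_mul_cancel₀ hc,
        one_smul]
  · exact inf_le_inf_right _ le_sup_left

/-- Lemma B (B2, first half): one more bit raises the structure inside any fixed subspace `N` by at most one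
(any finite-dimensional space). -/
theorem finrank_sup_span_inf_le {V : Type*} [AddCommGroup V] [Module 𝕜 V] [FiniteDimensional 𝕜 V]
    (X N : Submodule 𝕜 V) (x : V) :
    Module.finrank 𝕜 ↥((X ⊔ 𝕜 ∙ x) ⊓ N) ≤ Module.finrank 𝕜 ↥(X ⊓ N) + 1 := by
  set P := (X ⊔ 𝕜 ∙ x) ⊓ N with hP
  let ψ : P →ₗ[𝕜] V ⧸ X := X.mkQ ∘ₗ P.subtype
  have hker : Submodule.map P.subtype (LinearMap.ker ψ) ≤ X ⊓ N := by
    rintro v ⟨y, hy, rfl⟩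
    rw [SetLike.mem_coe, LinearMap.mem_ker] at hy
    have hyX : (y : V) ∈ X := by
      simpa [ψ] using hy
    exact ⟨hyX, y.2.2⟩
  have hrange : LinearMap.range ψ ≤ 𝕜 ∙ (X.mkQ x) := by
    rintro q ⟨y, rfl⟩
    have hy1 : (y : V) ∈ X ⊔ 𝕜 ∙ x := y.2.1
    rw [Submodule.mem_sup] at hy1
    obtain ⟨w, hw, z, hz, hyz⟩ := hy1
    rw [Submodule.mem_span_singleton] at hz
    obtain ⟨c, rfl⟩ := hz
    rw [Submodule.mem_span_singleton]
    refine ⟨c, ?_⟩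
    simp only [ψ, LinearMap.coe_comp, Function.comp_apply, Submodule.coe_subtype, Submodule.mkQ_apply]
    rw [← hyz, Submodule.Quotient.mk_add, (Submodule.Quotient.mk_eq_zero X).2 hw, zero_add, Submodule.Quotient.mk_smul]
  have h1 : Module.finrank 𝕜 (LinearMap.range ψ) ≤ 1 := by
    calc Module.finrank 𝕜 (LinearMap.range ψ) ≤ Module.finrank 𝕜 ↥(𝕜 ∙ X.mkQ x) := Submodule.finrank_mono hrange
      _ ≤ 1 := by
        have := finrank_span_le_card (R := 𝕜) ({X.mkQ x} : Set (V ⧸ X))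
        simpa using this
  have h2 : Module.finrank 𝕜 (LinearMap.ker ψ) ≤ Module.finrank 𝕜 ↥(X ⊓ N) := by
    calc Module.finrank 𝕜 (LinearMap.ker ψ)
        = Module.finrank 𝕜 (Submodule.map P.subtype (LinearMap.ker ψ)) := (Submodule.finrank_map_subtype_eq P _).symm
      _ ≤ Module.finrank 𝕜 ↥(X ⊓ N) := Submodule.finrank_mono hker
  have h3 := LinearMap.finrank_range_add_finrank_ker ψ
  omega

/-- Lemma A (i), load step: a bit raises the load `dim π_a W` by exactly one if it is `a`-fresh … -/
theorem finrank_sup_span_of_not_mem {V : Type*} [AddCommGroup V] [Module 𝕜 V] [FiniteDimensional 𝕜 V]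
    (P : Submodule 𝕜 V) {v : V} (hv : v ∉ P) :
    Module.finrank 𝕜 ↥(P ⊔ 𝕜 ∙ v) = Module.finrank 𝕜 P + 1 := by
  apply le_antisymm
  · have := finrank_sup_span_inf_le P ⊤ v
    rw [inf_top_eq, inf_top_eq] at this
    exact this
  · have hlt : P < P ⊔ 𝕜 ∙ v := by
      refine lt_of_le_of_ne le_sup_left fun h => hv ?_
      rw [h]
      exact Submodule.mem_sup_right (Submodule.mem_span_singleton_self v)
    have := Submodule.finrank_lt_finrank_of_lt hlt
    omega

/-- … and not at all otherwise. -/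
theorem sup_span_of_mem {V : Type*} [AddCommGroup V] [Module 𝕜 V]
    (P : Submodule 𝕜 V) {v : V} (hv : v ∈ P) : P ⊔ 𝕜 ∙ v = P :=
  sup_eq_left.2 ((Submodule.span_singleton_le_iff_mem v P).2 hv)

omit [Fintype ι] [FiniteDimensional 𝕜 M] in
/-- Lemma A (i), projections: the load of row `a` sees a bit `x` exactly through `x a` … -/
theorem map_proj_sup_span (X : Submodule 𝕜 (ι → M)) (x : ι → M) (a : ι) :
    Submodule.map (LinearMap.proj a : (ι → M) →ₗ[𝕜] M) (X ⊔ 𝕜 ∙ x)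
      = Submodule.map (LinearMap.proj a : (ι → M) →ₗ[𝕜] M) X ⊔ 𝕜 ∙ (x a) := by
  rw [Submodule.map_sup, Submodule.map_span, Set.image_singleton, LinearMap.proj_apply]

omit [Fintype ι] [FiniteDimensional 𝕜 M] in
/-- … and does not see closures of other rows (`π_a ∘ π_{¬Z} = π_a` for `a ∉ Z`). -/
theorem map_proj_map_killRows (X : Submodule 𝕜 (ι → M)) {Z : Finset ι} {a : ι} (ha : a ∉ Z) :
    Submodule.map (LinearMap.proj a : (ι → M) →ₗ[𝕜] M) (Submodule.map (killRows Z) X)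
      = Submodule.map (LinearMap.proj a : (ι → M) →ₗ[𝕜] M) X := by
  rw [← Submodule.map_comp]
  congr 1
  ext v
  simp [ha]

/-- Lemma B (B2 second half / B3), the projection formula (π): for disjoint row sets `T`, `Z`,
`dim(π_{¬Z} X ∩ V_T) + dim(X ∩ V_Z) = dim(X ∩ V_{T ∪ Z})`. -/
theorem finrank_map_killRows_inf_add (X : Submodule 𝕜 (ι → M)) (T Z : Finset ι) :
    Module.finrank 𝕜 ↥(Submodule.map (killRows Z) X ⊓ rowSupp T) + Module.finrank 𝕜 ↥(X ⊓ rowSupp Z)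
      = Module.finrank 𝕜 ↥(X ⊓ rowSupp (T ∪ Z)) := by
  set Y := X ⊓ rowSupp (𝕜 := 𝕜) (M := M) (T ∪ Z) with hY
  let φ : Y →ₗ[𝕜] (ι → M) := (killRows Z) ∘ₗ Y.subtype
  have hrange : LinearMap.range φ = Submodule.map (killRows Z) X ⊓ rowSupp T := by
    apply le_antisymm
    · rintro v ⟨y, rfl⟩
      refine ⟨⟨y, y.2.1, rfl⟩, ?_⟩
      show killRows Z (y : ι → M) ∈ rowSupp T
      rw [mem_rowSupp]
      intro j hj
      simp only [killRows_apply]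
      split_ifs with hjZ
      · rfl
      · exact (mem_rowSupp.1 y.2.2) j (by simp [Finset.mem_union, hj, hjZ])
    · rintro v ⟨⟨x', hx', rfl⟩, hvT⟩
      have hxY : x' ∈ Y := by
        refine ⟨hx', mem_rowSupp.2 fun j hj => ?_⟩
        rw [Finset.mem_union, not_or] at hj
        have := (mem_rowSupp.1 hvT) j hj.1
        simpa [killRows_apply, hj.2] using this
      exact ⟨⟨x', hxY⟩, rfl⟩
  have hle : X ⊓ rowSupp Z ≤ Y := inf_le_inf_left X (rowSupp_mono Finset.subset_union_right)
  have hker : LinearMap.ker φ = Submodule.comap Y.subtype (X ⊓ rowSupp Z) := by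
    ext y
    simp only [LinearMap.mem_ker, Submodule.mem_comap, Submodule.coe_subtype, Submodule.mem_inf, φ,
      LinearMap.coe_comp, Function.comp_apply]
    constructor
    · intro h
      exact ⟨y.2.1, (LinearMap.mem_ker).2 h⟩
    · intro h
      exact (LinearMap.mem_ker).1 h.2
  have hkfin : Module.finrank 𝕜 (LinearMap.ker φ) = Module.finrank 𝕜 ↥(X ⊓ rowSupp Z) := by
    rw [hker]
    exact LinearEquiv.finrank_eq (Submodule.comapSubtypeEquivOfLe hle)
  have h := LinearMap.finrank_range_add_finrank_ker φ
  rw [hrange, hkfin] at h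
  exact h

omit [Fintype ι] [FiniteDimensional 𝕜 M] in
/-- `W ∩ V_T ⊆ π_{¬Z}(W) ∩ V_T` for `T ∩ Z = ∅` (a vector with no `Z`-components is its own projection). -/
theorem inf_rowSupp_le_map_killRows_inf (X : Submodule 𝕜 (ι → M)) {T Z : Finset ι} (hTZ : Disjoint T Z) :
    X ⊓ rowSupp T ≤ Submodule.map (killRows Z) X ⊓ rowSupp T := by
  rintro v ⟨hvX, hvT⟩
  refine ⟨⟨v, hvX, ?_⟩, hvT⟩
  funext j
  rw [killRows_apply]
  split_ifs with hjZ
  · exact ((mem_rowSupp.1 hvT) j (fun hjT => (Finset.disjoint_left.1 hTZ) hjT hjZ)).symm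
  · rfl

omit [Fintype ι] [FiniteDimensional 𝕜 M] in
/-- Projecting out MORE dead rows only enlarges what is seen on live rows: `π_{¬Z}(W) ∩ V_T ⊆ π_{¬D}(W) ∩ V_T`
for `Z ⊆ D`, `T ∩ D = ∅`. -/
theorem map_killRows_inf_le_of_subset (X : Submodule 𝕜 (ι → M)) {T Z D : Finset ι} (hZD : Z ⊆ D)
    (hTD : Disjoint T D) :
    Submodule.map (killRows Z) X ⊓ rowSupp T ≤ Submodule.map (killRows D) X ⊓ rowSupp T := by
  rintro v ⟨⟨w, hw, rfl⟩, hvT⟩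
  refine ⟨⟨w, hw, ?_⟩, hvT⟩
  funext j
  have hv0 := (mem_rowSupp.1 hvT) j
  simp only [killRows_apply] at hv0 ⊢
  by_cases hjD : j ∈ D
  · rw [if_pos hjD]
    by_cases hjZ : j ∈ Z
    · rw [if_pos hjZ]
    · rw [if_neg hjZ]
      have := hv0 (fun hjT => (Finset.disjoint_left.1 hTD) hjT hjD)
      rw [if_neg hjZ] at this
      exact this.symm
  · rw [if_neg hjD, if_neg (fun hjZ => hjD (hZD hjZ))]

/-- Row blocks are independent: `Σ_{q ∈ Q} dim(X ∩ V_q) ≤ dim(X ∩ V_Q)`. -/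
theorem sum_finrank_inf_rowSupp_singleton_le (X : Submodule 𝕜 (ι → M)) (Q : Finset ι) :
    ∑ q ∈ Q, Module.finrank 𝕜 ↥(X ⊓ rowSupp {q}) ≤ Module.finrank 𝕜 ↥(X ⊓ rowSupp Q) := by
  refine Finset.induction_on Q (by simp) ?_
  intro q Q' hq ih
  rw [Finset.sum_insert hq]
  have hdisj : Disjoint Q' ({q} : Finset ι) := Finset.disjoint_singleton_right.2 hq
  have hπ := finrank_map_killRows_inf_add X Q' {q}
  have hmono : Module.finrank 𝕜 ↥(X ⊓ rowSupp Q') ≤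
      Module.finrank 𝕜 ↥(Submodule.map (killRows {q}) X ⊓ rowSupp Q') :=
    Submodule.finrank_mono (inf_rowSupp_le_map_killRows_inf X hdisj)
  have hins : insert q Q' = Q' ∪ {q} := by
    ext j; simp
  rw [hins, ← hπ]
  omega

/-- FACT C1 of `LensBarrierP4g22` §1 (`close_info`'s rank assertion): the pivot space `F_{i₀}` and the link spaces
`T̃_q = X ∩ V_{i₀,q}` of distinct rows `q` are independent modulo `F_{i₀}`:
`f_{i₀} + Σ_q (dim T̃_q − f_{i₀}) ≤ dim(X ∩ V_{Q ∪ i₀})`. -/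
theorem factC1 (X : Submodule 𝕜 (ι → M)) (i₀ : ι) (Q : Finset ι) :
    Module.finrank 𝕜 ↥(X ⊓ rowSupp {i₀})
      + ∑ q ∈ Q, (Module.finrank 𝕜 ↥(X ⊓ rowSupp ({q} ∪ {i₀})) - Module.finrank 𝕜 ↥(X ⊓ rowSupp {i₀}))
      ≤ Module.finrank 𝕜 ↥(X ⊓ rowSupp (Q ∪ {i₀})) := by
  have hπ := finrank_map_killRows_inf_add X Q {i₀}
  have hS := sum_finrank_inf_rowSupp_singleton_le (Submodule.map (killRows {i₀}) X) Q
  have hterm : ∀ q ∈ Q, Module.finrank 𝕜 ↥(X ⊓ rowSupp ({q} ∪ {i₀})) - Module.finrank 𝕜 ↥(X ⊓ rowSupp {i₀})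
      = Module.finrank 𝕜 ↥(Submodule.map (killRows {i₀}) X ⊓ rowSupp {q}) := by
    intro q hq
    have := finrank_map_killRows_inf_add X {q} {i₀}
    omega
  rw [Finset.sum_congr rfl hterm]
  omega

/-- Lemma B (B2) assembled: at a bit `x` killing the rows `Q` (each killed row `q` carrying a pivot space of
dimension ≥ 2 in `W ⊔ x`), the structure off row `a` — measured on the surviving rows `T` after projecting the
killed rows out — satisfies `ḡ' + 2|Q| ≤ ḡ + 1` where `ḡ = dim(W ∩ V_{T ∪ Q})`. -/
theorem structure_step_bit (W : Submodule 𝕜 (ι → M)) (x : ι → M) (T Q : Finset ι)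
    (hkill : ∀ q ∈ Q, 2 ≤ Module.finrank 𝕜 ↥((W ⊔ 𝕜 ∙ x) ⊓ rowSupp {q})) :
    Module.finrank 𝕜 ↥(Submodule.map (killRows Q) (W ⊔ 𝕜 ∙ x) ⊓ rowSupp T) + 2 * Q.card
      ≤ Module.finrank 𝕜 ↥(W ⊓ rowSupp (T ∪ Q)) + 1 := by
  have hπ := finrank_map_killRows_inf_add (W ⊔ 𝕜 ∙ x) T Q
  have h1 := finrank_sup_span_inf_le W (rowSupp (T ∪ Q)) x
  have hS := sum_finrank_inf_rowSupp_singleton_le (W ⊔ 𝕜 ∙ x) Q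
  have hcard : 2 * Q.card ≤ ∑ q ∈ Q, Module.finrank 𝕜 ↥((W ⊔ 𝕜 ∙ x) ⊓ rowSupp {q}) := by
    calc 2 * Q.card = ∑ _q ∈ Q, 2 := by simp [mul_comm]
      _ ≤ _ := Finset.sum_le_sum hkill
  omega

/-- Lemma B (B1) assembled: an `a`-fresh bit leaves the structure off row `a` unchanged (and kills nothing:
no pivot space `F_j`, `j ≠ a`, rises — the case `T = {j}`). -/
theorem structure_step_fresh (W : Submodule 𝕜 (ι → M)) {x : ι → M} {a : ι} (T : Finset ι) (ha : a ∉ T)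
    (hfresh : x a ∉ Submodule.map (LinearMap.proj a : (ι → M) →ₗ[𝕜] M) W) :
    Module.finrank 𝕜 ↥((W ⊔ 𝕜 ∙ x) ⊓ rowSupp T) = Module.finrank 𝕜 ↥(W ⊓ rowSupp T) := by
  rw [sup_span_inf_rowSupp_of_fresh ha hfresh]

/-- Lemma B (B3) assembled, closure of an ALIVE row `i₀` killing `Q`: with `W̄ = π_{¬D}(W)` (`D` = dead rows,
disjoint from `Q ∪ i₀`), surviving rows `T`, pivot `f_{i₀} = dim(W ∩ V_{i₀})` and links measured by
`dim(W ∩ V_{q,i₀}) − f_{i₀} = f_q + m_q`:  `ḡ' + f_{i₀} + Σ_q (f_q + m_q) ≤ ḡ`. -/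
theorem structure_step_close (W : Submodule 𝕜 (ι → M)) (D T Q : Finset ι) {i₀ : ι}
    (hD : Disjoint (Q ∪ {i₀}) D) :
    Module.finrank 𝕜 ↥(Submodule.map (killRows (Q ∪ {i₀})) (Submodule.map (killRows D) W) ⊓ rowSupp T)
      + Module.finrank 𝕜 ↥(W ⊓ rowSupp {i₀})
      + ∑ q ∈ Q, (Module.finrank 𝕜 ↥(W ⊓ rowSupp ({q} ∪ {i₀})) - Module.finrank 𝕜 ↥(W ⊓ rowSupp {i₀}))
      ≤ Module.finrank 𝕜 ↥(Submodule.map (killRows D) W ⊓ rowSupp (T ∪ (Q ∪ {i₀}))) := by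
  have hπ := finrank_map_killRows_inf_add (Submodule.map (killRows D) W) T (Q ∪ {i₀})
  have hC1 := factC1 W i₀ Q
  have hmono : Module.finrank 𝕜 ↥(W ⊓ rowSupp (Q ∪ {i₀}))
      ≤ Module.finrank 𝕜 ↥(Submodule.map (killRows D) W ⊓ rowSupp (Q ∪ {i₀})) :=
    Submodule.finrank_mono (inf_rowSupp_le_map_killRows_inf W hD)
  omega

/-- Lemma B (B3) assembled, closure of a DEAD row `i₀ ∈ D` killing `Q` (`Q ∩ D = ∅`):
`ḡ' + Σ_q (f_q + m_q) ≤ ḡ`, the links to the dead pivot being visible in `W̄ ∩ V_q`. -/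
theorem structure_step_deadclose (W : Submodule 𝕜 (ι → M)) (D T Q : Finset ι) {i₀ : ι}
    (hiD : i₀ ∈ D) (hQD : Disjoint Q D) :
    Module.finrank 𝕜 ↥(Submodule.map (killRows Q) (Submodule.map (killRows D) W) ⊓ rowSupp T)
      + ∑ q ∈ Q, (Module.finrank 𝕜 ↥(W ⊓ rowSupp ({q} ∪ {i₀})) - Module.finrank 𝕜 ↥(W ⊓ rowSupp {i₀}))
      ≤ Module.finrank 𝕜 ↥(Submodule.map (killRows D) W ⊓ rowSupp (T ∪ Q)) := by
  have hπ := finrank_map_killRows_inf_add (Submodule.map (killRows D) W) T Q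
  have hS := sum_finrank_inf_rowSupp_singleton_le (Submodule.map (killRows D) W) Q
  have hterm : ∀ q ∈ Q, Module.finrank 𝕜 ↥(W ⊓ rowSupp ({q} ∪ {i₀})) - Module.finrank 𝕜 ↥(W ⊓ rowSupp {i₀})
      ≤ Module.finrank 𝕜 ↥(Submodule.map (killRows D) W ⊓ rowSupp {q}) := by
    intro q hq
    have h1 := finrank_map_killRows_inf_add W {q} {i₀}
    have hqD : Disjoint ({q} : Finset ι) D :=
      Finset.disjoint_singleton_left.2 (fun h => (Finset.disjoint_left.1 hQD) hq h)
    have h2 : Module.finrank 𝕜 ↥(Submodule.map (killRows {i₀}) W ⊓ rowSupp {q})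
        ≤ Module.finrank 𝕜 ↥(Submodule.map (killRows D) W ⊓ rowSupp {q}) :=
      Submodule.finrank_mono (map_killRows_inf_le_of_subset W (Finset.singleton_subset_iff.2 hiD) hqD)
    omega
  have := Finset.sum_le_sum hterm
  omega

omit [Fintype ι] [FiniteDimensional 𝕜 M] in
/-- Bookkeeping: successive projections compose (`π_{¬A} ∘ π_{¬B} = π_{¬(B ∪ A)}`), so `W̄` after a kill / closure is
`π_{¬(new dead ∪ closed)}` of the old `W̄`. -/
theorem map_killRows_map_killRows (X : Submodule 𝕜 (ι → M)) (A B : Finset ι) :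
    Submodule.map (killRows A) (Submodule.map (killRows B) X) = Submodule.map (killRows (B ∪ A)) X := by
  rw [← Submodule.map_comp]
  congr 1
  ext v j
  simp only [LinearMap.coe_comp, Function.comp_apply, killRows_apply, Finset.mem_union]
  by_cases hA : j ∈ A <;> by_cases hB : j ∈ B <;> simp [hA, hB]


/-- Lemma D (no clean sweep), linear-algebra core: on linearly independent tags every value pattern is realised by
some functional — so for any designer offsets the adversary has a `γ` that does NOT violate a chosen candidate block
(its `m_j` tags are independent, FACT C1), i.e. a closure kills at most `#candidates − 1` rows. -/
theorem exists_functional_of_linearIndependent {V : Type*} [AddCommGroup V] [Module 𝕜 V] {m : Type*}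
    {t : m → V} (ht : LinearIndependent 𝕜 t) (s : m → 𝕜) : ∃ γ : V →ₗ[𝕜] 𝕜, ∀ i, γ (t i) = s i := by
  classical
  let b := Basis.span ht
  obtain ⟨g, hg⟩ := LinearMap.exists_extend (b.constr 𝕜 s)
  refine ⟨g, fun i => ?_⟩
  have h1 : g ((b i : V)) = b.constr 𝕜 s (b i) := by
    rw [← hg]
    rfl
  rw [Basis.constr_basis] at h1
  have h2 : ((b i : _) : V) = t i := by
    rw [show b i = (⟨t i, _⟩ : _) from Basis.span_apply ht i]
  rw [h2] at h1
  exact h1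


end LinAlg

/-! ## §5 The books as a nondeterministic machine over subspaces, and (J′) / (BANK\*)₀ for every run

The state machine below is `bank3.Books` with the adversary's choices left nondeterministic and the candidate sets
slightly ENLARGED (this only strengthens the theorem): a bit may kill any proper subset `Q` of its candidates
(undeclared alive rows whose pivot space `F_q = W ∩ V_q` had dimension ≥ 1 and rises); a closure of an undeclared row
`i₀` (alive or dead) may kill any proper subset of its candidates (undeclared alive `j ≠ i₀` with
`dim(W ∩ V_{j,i₀}) ≥ f_{i₀} + 2`, i.e. `f_j + m_j ≥ 2`); a `purge` projects the coordinates of one DEAD row out of `W` at no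
cost (no event).  `bank3`'s rules (`⌊|C|/2⌋` kills, `κ ≤ |C| − 1` kills by Lemma D) are instances, with dead rows keeping their
coordinates (semantics S1 of the memo, no purges); the variant books `BooksP` (semantics S2/`P`: dead rows projected out at once,
later bits' dead components dropped) are instances too — each of their events is a `bit`/`close` followed by purges of the killed
rows.  Declared rows are pinned (`P`). -/

section Machine

open Module

variable {𝕜 : Type*} [Field 𝕜] {ι : Type*} [Fintype ι] [DecidableEq ι]
  {M : Type*} [AddCommGroup M] [Module 𝕜 M] [FiniteDimensional 𝕜 M]

variable (𝕜 ι M) in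
/-- A state of the books: `W` = span of the undeclared parts of the bits, `U` undeclared rows, `A` alive rows, `P a` the
pinned space of a declared row, `K` kills, `B` bits, `c` closures. -/
structure BState where
  W : Submodule 𝕜 (ι → M)
  U : Finset ι
  A : Finset ι
  P : ι → Submodule 𝕜 M
  K : ℕ
  B : ℕ
  c : ℕ

namespace BState

variable (s : BState 𝕜 ι M)

/-- undeclared alive rows `UA` -/
def ua : Finset ι := s.U ∩ s.A
/-- dead undeclared rows -/
def dead : Finset ι := s.U \ s.A
/-- pivot dimension `f_j = dim(W ∩ V_j)` -/
noncomputable def piv (j : ι) : ℕ := finrank 𝕜 ↥(s.W ⊓ rowSupp {j})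
/-- load `dim π_a W` -/
noncomputable def load (a : ι) : ℕ := finrank 𝕜 ↥(Submodule.map (LinearMap.proj a : (ι → M) →ₗ[𝕜] M) s.W)
/-- depth: load for undeclared rows, pinned dimension for declared rows -/
noncomputable def depth (a : ι) : ℕ := if a ∈ s.U then s.load a else finrank 𝕜 ↥(s.P a)
/-- `W̄ = π_{¬Dead} W` -/
def Wbar : Submodule 𝕜 (ι → M) := Submodule.map (killRows s.dead) s.W
/-- `ḡ_a = dim(W̄ ∩ V_{UA ∖ a})` -/
noncomputable def gbar (a : ι) : ℕ := finrank 𝕜 ↥(s.Wbar ⊓ rowSupp (s.ua.erase a))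
/-- the undeclared part of a bit -/
def rem (x : ι → M) : ι → M := killRows (𝕜 := 𝕜) (Finset.univ \ s.U) x
/-- EQ-kill candidates (enlarged): undeclared alive rows whose pivot space is nonzero and rises -/
noncomputable def bitCand (x : ι → M) : Finset ι :=
  s.ua.filter fun q => 1 ≤ s.piv q ∧ s.piv q < finrank 𝕜 ↥((s.W ⊔ 𝕜 ∙ s.rem x) ⊓ rowSupp {q})
/-- CLOSE candidates (enlarged): undeclared alive `j ≠ i₀` with `f_j + m_j ≥ 2` -/
noncomputable def closeCand (i₀ : ι) : Finset ι :=
  (s.ua.erase i₀).filter fun j => s.piv i₀ + 2 ≤ finrank 𝕜 ↥(s.W ⊓ rowSupp ({j} ∪ {i₀}))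

/-- the state after a bit `x` killing `Q` -/
def bit (x : ι → M) (Q : Finset ι) : BState 𝕜 ι M where
  W := s.W ⊔ 𝕜 ∙ s.rem x
  U := s.U
  A := s.A \ Q
  P := fun j => s.P j ⊔ 𝕜 ∙ x j
  K := s.K + Q.card
  B := s.B + 1
  c := s.c

/-- the state after closing the undeclared row `i₀` killing `Q` -/
def close (i₀ : ι) (Q : Finset ι) : BState 𝕜 ι M where
  W := Submodule.map (killRows {i₀}) s.W
  U := s.U.erase i₀
  A := s.A \ Q
  P := Function.update s.P i₀ (Submodule.map (LinearMap.proj i₀ : (ι → M) →ₗ[𝕜] M) s.W)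
  K := s.K + Q.card
  B := s.B
  c := s.c + 1

/-- the state after purging the dead row `i₀` from `W` (semantics `P`; not an event) -/
def purge (i₀ : ι) : BState 𝕜 ι M where
  W := Submodule.map (killRows {i₀}) s.W
  U := s.U
  A := s.A
  P := s.P
  K := s.K
  B := s.B
  c := s.c

variable (𝕜 ι M) in
/-- the initial state -/
def init : BState 𝕜 ι M where
  W := ⊥
  U := Finset.univ
  A := Finset.univ
  P := fun _ => ⊥
  K := 0
  B := 0
  c := 0

/-- One event of the books (or a stutter). -/
inductive Step : BState 𝕜 ι M → BState 𝕜 ι M → Prop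
  | idle (s : BState 𝕜 ι M) : Step s s
  | bit (s : BState 𝕜 ι M) (x : ι → M) (Q : Finset ι) (hQ : Q ⊆ s.bitCand x)
      (hlt : (s.bitCand x).Nonempty → Q ≠ s.bitCand x) : Step s (s.bit x Q)
  | close (s : BState 𝕜 ι M) (i₀ : ι) (Q : Finset ι) (hi : i₀ ∈ s.U) (hQ : Q ⊆ s.closeCand i₀)
      (hlt : (s.closeCand i₀).Nonempty → Q ≠ s.closeCand i₀) : Step s (s.close i₀ Q)
  | purge (s : BState 𝕜 ι M) (i₀ : ι) (hi : i₀ ∈ s.dead) : Step s (s.purge i₀)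

section simp_lemmas
variable (x : ι → M) (Q : Finset ι) (i₀ j : ι)
@[simp] theorem bit_W : (s.bit x Q).W = s.W ⊔ 𝕜 ∙ s.rem x := rfl
@[simp] theorem bit_U : (s.bit x Q).U = s.U := rfl
@[simp] theorem bit_A : (s.bit x Q).A = s.A \ Q := rfl
@[simp] theorem bit_P : (s.bit x Q).P j = s.P j ⊔ 𝕜 ∙ x j := rfl
@[simp] theorem bit_K : (s.bit x Q).K = s.K + Q.card := rfl
@[simp] theorem bit_B : (s.bit x Q).B = s.B + 1 := rfl
@[simp] theorem bit_c : (s.bit x Q).c = s.c := rfl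
@[simp] theorem close_W : (s.close i₀ Q).W = Submodule.map (killRows {i₀}) s.W := rfl
@[simp] theorem close_U : (s.close i₀ Q).U = s.U.erase i₀ := rfl
@[simp] theorem close_A : (s.close i₀ Q).A = s.A \ Q := rfl
@[simp] theorem close_P : (s.close i₀ Q).P =
    Function.update s.P i₀ (Submodule.map (LinearMap.proj i₀ : (ι → M) →ₗ[𝕜] M) s.W) := rfl
@[simp] theorem close_K : (s.close i₀ Q).K = s.K + Q.card := rfl
@[simp] theorem close_B : (s.close i₀ Q).B = s.B := rfl
@[simp] theorem close_c : (s.close i₀ Q).c = s.c + 1 := rfl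
@[simp] theorem purge_W : (s.purge i₀).W = Submodule.map (killRows {i₀}) s.W := rfl
@[simp] theorem purge_U : (s.purge i₀).U = s.U := rfl
@[simp] theorem purge_A : (s.purge i₀).A = s.A := rfl
@[simp] theorem purge_P : (s.purge i₀).P = s.P := rfl
@[simp] theorem purge_K : (s.purge i₀).K = s.K := rfl
@[simp] theorem purge_B : (s.purge i₀).B = s.B := rfl
@[simp] theorem purge_c : (s.purge i₀).c = s.c := rfl
theorem purge_ua : (s.purge i₀).ua = s.ua := rfl
theorem purge_dead : (s.purge i₀).dead = s.dead := rfl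
end simp_lemmas

variable {s}

theorem mem_ua {a : ι} : a ∈ s.ua ↔ a ∈ s.U ∧ a ∈ s.A := Finset.mem_inter
theorem mem_dead {a : ι} : a ∈ s.dead ↔ a ∈ s.U ∧ a ∉ s.A := Finset.mem_sdiff
theorem bitCand_sub (x : ι → M) : s.bitCand x ⊆ s.ua := Finset.filter_subset _ _
theorem closeCand_sub (i₀ : ι) : s.closeCand i₀ ⊆ s.ua.erase i₀ := Finset.filter_subset _ _
theorem not_mem_dead_of_mem_ua {a : ι} (h : a ∈ s.ua) : a ∉ s.dead := fun h' => (mem_dead.1 h').2 (mem_ua.1 h).2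

theorem rem_apply_of_mem (x : ι → M) {a : ι} (ha : a ∈ s.U) : s.rem x a = x a := by
  simp [rem, killRows_apply, ha]

theorem alive_sdiff_decl (s : BState 𝕜 ι M) : s.A \ (s.A \ s.U) = s.ua := by
  ext j
  simp only [Finset.mem_sdiff, mem_ua, not_and, not_not]
  tauto

theorem bit_ua (x : ι → M) (Q : Finset ι) : (s.bit x Q).ua = s.ua \ Q := by
  ext j
  simp only [ua, bit_U, bit_A, Finset.mem_inter, Finset.mem_sdiff]
  tauto

theorem bit_dead (x : ι → M) {Q : Finset ι} (hQ : Q ⊆ s.ua) : (s.bit x Q).dead = s.dead ∪ Q := by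
  ext j
  simp only [dead, bit_U, bit_A, Finset.mem_sdiff, Finset.mem_union, not_and, not_not]
  constructor
  · rintro ⟨hjU, h⟩
    by_cases hjA : j ∈ s.A
    · exact Or.inr (h hjA)
    · exact Or.inl ⟨hjU, hjA⟩
  · rintro (⟨hjU, hjA⟩ | hjQ)
    · exact ⟨hjU, fun h => (hjA h).elim⟩
    · exact ⟨(mem_ua.1 (hQ hjQ)).1, fun _ => hjQ⟩

theorem close_ua (i₀ : ι) (Q : Finset ι) : (s.close i₀ Q).ua = (s.ua.erase i₀) \ Q := by
  ext j
  simp only [ua, close_U, close_A, Finset.mem_inter, Finset.mem_sdiff, Finset.mem_erase]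
  tauto

/-- total projected set after closing an ALIVE row: `{i₀} ∪ Dead' = Dead ∪ (Q ∪ {i₀})` -/
theorem close_proj_alive {i₀ : ι} {Q : Finset ι} (hi : i₀ ∈ s.U) (hiA : i₀ ∈ s.A) (hQ : Q ⊆ s.ua.erase i₀) :
    {i₀} ∪ (s.close i₀ Q).dead = s.dead ∪ (Q ∪ {i₀}) := by
  ext j
  simp only [dead, close_U, close_A, Finset.mem_union, Finset.mem_singleton, Finset.mem_sdiff, Finset.mem_erase,
    not_and, not_not]
  by_cases hji : j = i₀
  · subst hji; simp [hi, hiA]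
  · constructor
    · rintro (h | ⟨⟨-, hjU⟩, h⟩)
      · exact (hji h).elim
      · by_cases hjA : j ∈ s.A
        · exact Or.inr (Or.inl (h hjA))
        · exact Or.inl ⟨hjU, hjA⟩
    · rintro (⟨hjU, hjA⟩ | hjQ | h)
      · exact Or.inr ⟨⟨hji, hjU⟩, fun h => (hjA h).elim⟩
      · have := Finset.mem_erase.1 (hQ hjQ)
        exact Or.inr ⟨⟨hji, (mem_ua.1 this.2).1⟩, fun _ => hjQ⟩
      · exact (hji h).elim

/-- total projected set after closing a DEAD row: `{i₀} ∪ Dead' = Dead ∪ Q` -/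
theorem close_proj_dead {i₀ : ι} {Q : Finset ι} (hi : i₀ ∈ s.U) (hiA : i₀ ∉ s.A) (hQ : Q ⊆ s.ua.erase i₀) :
    {i₀} ∪ (s.close i₀ Q).dead = s.dead ∪ Q := by
  ext j
  simp only [dead, close_U, close_A, Finset.mem_union, Finset.mem_singleton, Finset.mem_sdiff, Finset.mem_erase,
    not_and, not_not]
  by_cases hji : j = i₀
  · subst hji; simp [hi, hiA]
  · constructor
    · rintro (h | ⟨⟨-, hjU⟩, h⟩)
      · exact (hji h).elim
      · by_cases hjA : j ∈ s.A
        · exact Or.inr (h hjA)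
        · exact Or.inl ⟨hjU, hjA⟩
    · rintro (⟨hjU, hjA⟩ | hjQ)
      · exact Or.inr ⟨⟨hji, hjU⟩, fun h => (hjA h).elim⟩
      · have := Finset.mem_erase.1 (hQ hjQ)
        exact Or.inr ⟨⟨hji, (mem_ua.1 this.2).1⟩, fun _ => hjQ⟩

omit [Fintype ι] [FiniteDimensional 𝕜 M] in
theorem killRows_empty : killRows (𝕜 := 𝕜) (M := M) (∅ : Finset ι) = LinearMap.id := by
  ext v j
  simp [killRows_apply]

theorem two_mul_card_le_sum {Q : Finset ι} {f : ι → ℕ} (h : ∀ q ∈ Q, 2 ≤ f q) : 2 * Q.card ≤ ∑ q ∈ Q, f q := by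
  calc 2 * Q.card = ∑ _q ∈ Q, 2 := by simp [mul_comm]
    _ ≤ _ := Finset.sum_le_sum h

/-- Lemmas A + B at a bit: the per-row potential of a surviving undeclared row does not increase. -/
theorem row_step_bit (x : ι → M) {Q : Finset ι} (hQc : Q ⊆ s.bitCand x) {a : ι} (ha : a ∈ (s.bit x Q).ua) :
    2 * (s.bit x Q).K + (s.bit x Q).depth a + (s.bit x Q).gbar a + s.B
      ≤ 2 * s.K + s.depth a + s.gbar a + (s.bit x Q).B := by
  have hQua : Q ⊆ s.ua := hQc.trans (bitCand_sub x)
  rw [bit_ua] at ha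
  obtain ⟨haua, haQ⟩ := Finset.mem_sdiff.1 ha
  obtain ⟨haU, haA⟩ := mem_ua.1 haua
  have hadead : a ∉ s.dead := not_mem_dead_of_mem_ua haua
  have hd : s.depth a = s.load a := by simp [depth, haU]
  have hd' : (s.bit x Q).depth a
      = finrank 𝕜 ↥(Submodule.map (LinearMap.proj a : (ι → M) →ₗ[𝕜] M) s.W ⊔ 𝕜 ∙ x a) := by
    rw [← rem_apply_of_mem x haU, ← map_proj_sup_span]
    have : (s.bit x Q).depth a = (s.bit x Q).load a := by simp only [depth, bit_U, if_pos haU]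
    rw [this]
    rfl
  have hg : s.gbar a = finrank 𝕜 ↥(Submodule.map (killRows s.dead) s.W ⊓ rowSupp (s.ua.erase a)) := rfl
  have hg' : (s.bit x Q).gbar a = finrank 𝕜 ↥(Submodule.map (killRows Q)
      (Submodule.map (killRows s.dead) s.W ⊔ 𝕜 ∙ killRows (𝕜 := 𝕜) s.dead (s.rem x)) ⊓ rowSupp ((s.ua \ Q).erase a)) := by
    show finrank 𝕜 ↥(Submodule.map (killRows (s.bit x Q).dead) (s.W ⊔ 𝕜 ∙ s.rem x)
        ⊓ rowSupp ((s.bit x Q).ua.erase a)) = _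
    rw [bit_dead x hQua, bit_ua, ← map_killRows_map_killRows, Submodule.map_sup, Submodule.map_span,
      Set.image_singleton]
  have hfrW : (killRows (𝕜 := 𝕜) s.dead (s.rem x)) a = x a := by
    rw [killRows_apply, if_neg hadead, rem_apply_of_mem x haU]
  by_cases hfr : x a ∈ Submodule.map (LinearMap.proj a : (ι → M) →ₗ[𝕜] M) s.W
  · -- not an `a`-fresh bit: load fixed, structure pays for the kills
    have hd'2 : (s.bit x Q).depth a = s.load a := by
      rw [hd', sup_span_of_mem _ hfr]; rfl
    have hkill : ∀ q ∈ Q, 2 ≤ finrank 𝕜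
        ↥((Submodule.map (killRows s.dead) s.W ⊔ 𝕜 ∙ killRows (𝕜 := 𝕜) s.dead (s.rem x)) ⊓ rowSupp {q}) := by
      intro q hq
      have hqc := hQc hq
      simp only [bitCand, Finset.mem_filter] at hqc
      obtain ⟨hqua, h1, h2⟩ := hqc
      have hqdead : Disjoint ({q} : Finset ι) s.dead :=
        Finset.disjoint_singleton_left.2 (not_mem_dead_of_mem_ua hqua)
      have hle := inf_rowSupp_le_map_killRows_inf (s.W ⊔ 𝕜 ∙ s.rem x) hqdead
      rw [Submodule.map_sup, Submodule.map_span, Set.image_singleton] at hle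
      have := Submodule.finrank_mono hle
      omega
    have hstep := structure_step_bit (Submodule.map (killRows s.dead) s.W) (killRows (𝕜 := 𝕜) s.dead (s.rem x))
      ((s.ua \ Q).erase a) Q hkill
    have hT : (s.ua \ Q).erase a ∪ Q = s.ua.erase a := by
      ext j
      simp only [Finset.mem_union, Finset.mem_erase, Finset.mem_sdiff]
      constructor
      · rintro (⟨hne, hj, -⟩ | hj)
        · exact ⟨hne, hj⟩
        · exact ⟨fun h => haQ (h ▸ hj), hQua hj⟩
      · rintro ⟨hne, hj⟩
        by_cases hjQ : j ∈ Q
        · exact Or.inr hjQ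
        · exact Or.inl ⟨hne, hj, hjQ⟩
    rw [hT] at hstep
    rw [hg', hd'2, hd, hg, bit_K, bit_B]
    omega
  · -- an `a`-fresh bit: no kill, load +1, structure off `a` unchanged
    have hQe : Q = ∅ := by
      refine Finset.subset_empty.1 fun q hq => ?_
      exfalso
      have hqc := hQc hq
      simp only [bitCand, Finset.mem_filter] at hqc
      obtain ⟨hqua, h1, h2⟩ := hqc
      have hqa : a ∉ ({q} : Finset ι) := by
        rw [Finset.mem_singleton]
        exact fun h => haQ (h ▸ hq)
      have hfr' : (s.rem x) a ∉ Submodule.map (LinearMap.proj a : (ι → M) →ₗ[𝕜] M) s.W := by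
        rwa [rem_apply_of_mem x haU]
      rw [sup_span_inf_rowSupp_of_fresh hqa hfr'] at h2
      simp only [piv] at h2
      exact lt_irrefl _ h2
    subst hQe
    have hd'2 : (s.bit x ∅).depth a = s.load a + 1 := by
      rw [hd', finrank_sup_span_of_not_mem _ hfr]; rfl
    have hfrbar : (killRows (𝕜 := 𝕜) s.dead (s.rem x)) a
        ∉ Submodule.map (LinearMap.proj a : (ι → M) →ₗ[𝕜] M) (Submodule.map (killRows s.dead) s.W) := by
      rw [hfrW, map_proj_map_killRows _ hadead]
      exact hfr
    have haT : a ∉ (s.ua \ ∅).erase a := by simp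
    have hg'2 : (s.bit x ∅).gbar a = s.gbar a := by
      rw [hg', killRows_empty, Submodule.map_id, sup_span_inf_rowSupp_of_fresh haT hfrbar, hg, Finset.sdiff_empty]
    rw [hg'2, hd'2, hd, bit_K, bit_B, Finset.card_empty]
    omega

/-- Lemma B at a closure (alive or dead pivot row): the per-row potential of a surviving undeclared row does not
increase. -/
theorem row_step_close {i₀ : ι} (hi : i₀ ∈ s.U) {Q : Finset ι} (hQc : Q ⊆ s.closeCand i₀) {a : ι}
    (ha : a ∈ (s.close i₀ Q).ua) :
    2 * (s.close i₀ Q).K + (s.close i₀ Q).depth a + (s.close i₀ Q).gbar a + s.B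
      ≤ 2 * s.K + s.depth a + s.gbar a + (s.close i₀ Q).B := by
  have hQe : Q ⊆ s.ua.erase i₀ := hQc.trans (closeCand_sub i₀)
  have hQua : Q ⊆ s.ua := hQe.trans (Finset.erase_subset _ _)
  rw [close_ua] at ha
  obtain ⟨ha1, haQ⟩ := Finset.mem_sdiff.1 ha
  obtain ⟨hai, haua⟩ := Finset.mem_erase.1 ha1
  obtain ⟨haU, haA⟩ := mem_ua.1 haua
  have hd : s.depth a = s.load a := by simp [depth, haU]
  have hd' : (s.close i₀ Q).depth a = s.load a := by
    have haU' : a ∈ s.U.erase i₀ := Finset.mem_erase.2 ⟨hai, haU⟩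
    have hai' : a ∉ ({i₀} : Finset ι) := by rwa [Finset.mem_singleton]
    have : (s.close i₀ Q).depth a = (s.close i₀ Q).load a := by simp only [depth, close_U, if_pos haU']
    rw [this]
    show finrank 𝕜 ↥(Submodule.map (LinearMap.proj a : (ι → M) →ₗ[𝕜] M) (Submodule.map (killRows {i₀}) s.W)) = _
    rw [map_proj_map_killRows _ hai']
    rfl
  have hg : s.gbar a = finrank 𝕜 ↥(Submodule.map (killRows s.dead) s.W ⊓ rowSupp (s.ua.erase a)) := rfl
  have hsum : 2 * Q.card ≤ ∑ q ∈ Q,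
      (finrank 𝕜 ↥(s.W ⊓ rowSupp ({q} ∪ {i₀})) - finrank 𝕜 ↥(s.W ⊓ rowSupp {i₀})) := by
    refine two_mul_card_le_sum fun q hq => ?_
    have hqc := hQc hq
    simp only [closeCand, Finset.mem_filter, piv] at hqc
    omega
  have hQD : Disjoint Q s.dead :=
    Finset.disjoint_left.2 fun j hjQ hjd => not_mem_dead_of_mem_ua (hQua hjQ) hjd
  by_cases hiA : i₀ ∈ s.A
  · -- closing an ALIVE row
    have hD : Disjoint (Q ∪ {i₀}) s.dead := by
      rw [Finset.disjoint_union_left]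
      exact ⟨hQD, Finset.disjoint_singleton_left.2 (not_mem_dead_of_mem_ua (mem_ua.2 ⟨hi, hiA⟩))⟩
    have hg' : (s.close i₀ Q).gbar a = finrank 𝕜 ↥(Submodule.map (killRows (Q ∪ {i₀}))
        (Submodule.map (killRows s.dead) s.W) ⊓ rowSupp (((s.ua.erase i₀) \ Q).erase a)) := by
      show finrank 𝕜 ↥(Submodule.map (killRows (s.close i₀ Q).dead) (Submodule.map (killRows {i₀}) s.W)
          ⊓ rowSupp ((s.close i₀ Q).ua.erase a)) = _
      rw [close_ua, map_killRows_map_killRows, map_killRows_map_killRows, close_proj_alive hi hiA hQe]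
    have hstep := structure_step_close s.W s.dead (((s.ua.erase i₀) \ Q).erase a) Q (i₀ := i₀) hD
    have hT : ((s.ua.erase i₀) \ Q).erase a ∪ (Q ∪ {i₀}) = s.ua.erase a := by
      ext j
      simp only [Finset.mem_union, Finset.mem_erase, Finset.mem_sdiff, Finset.mem_singleton]
      constructor
      · rintro (⟨hne, ⟨-, hj⟩, -⟩ | hjQ | rfl)
        · exact ⟨hne, hj⟩
        · exact ⟨fun h => haQ (h ▸ hjQ), hQua hjQ⟩
        · exact ⟨fun h => hai h.symm, mem_ua.2 ⟨hi, hiA⟩⟩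
      · rintro ⟨hne, hj⟩
        by_cases hjQ : j ∈ Q
        · exact Or.inr (Or.inl hjQ)
        · by_cases hji : j = i₀
          · exact Or.inr (Or.inr hji)
          · exact Or.inl ⟨hne, ⟨hji, hj⟩, hjQ⟩
    rw [hT] at hstep
    rw [hg', hd', hd, hg, close_K, close_B]
    omega
  · -- closing a DEAD row
    have hiD : i₀ ∈ s.dead := mem_dead.2 ⟨hi, hiA⟩
    have hg' : (s.close i₀ Q).gbar a = finrank 𝕜 ↥(Submodule.map (killRows Q)
        (Submodule.map (killRows s.dead) s.W) ⊓ rowSupp (((s.ua.erase i₀) \ Q).erase a)) := by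
      show finrank 𝕜 ↥(Submodule.map (killRows (s.close i₀ Q).dead) (Submodule.map (killRows {i₀}) s.W)
          ⊓ rowSupp ((s.close i₀ Q).ua.erase a)) = _
      rw [close_ua, map_killRows_map_killRows, map_killRows_map_killRows, close_proj_dead hi hiA hQe]
    have hstep := structure_step_deadclose s.W s.dead (((s.ua.erase i₀) \ Q).erase a) Q hiD hQD
    have hi_ua : i₀ ∉ s.ua := fun h => hiA (mem_ua.1 h).2
    have hT : ((s.ua.erase i₀) \ Q).erase a ∪ Q = s.ua.erase a := by
      ext j
      simp only [Finset.mem_union, Finset.mem_erase, Finset.mem_sdiff]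
      constructor
      · rintro (⟨hne, ⟨-, hj⟩, -⟩ | hjQ)
        · exact ⟨hne, hj⟩
        · exact ⟨fun h => haQ (h ▸ hjQ), hQua hjQ⟩
      · rintro ⟨hne, hj⟩
        by_cases hjQ : j ∈ Q
        · exact Or.inr hjQ
        · exact Or.inl ⟨hne, ⟨fun h => hi_ua (h ▸ hj), hj⟩, hjQ⟩
    rw [hT] at hstep
    rw [hg', hd', hd, hg, close_K, close_B]
    omega

theorem map_proj_map_killRows_of_mem (X : Submodule 𝕜 (ι → M)) {Z : Finset ι} {a : ι} (ha : a ∈ Z) :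
    Submodule.map (LinearMap.proj a : (ι → M) →ₗ[𝕜] M) (Submodule.map (killRows Z) X) = ⊥ := by
  rw [← Submodule.map_comp]
  have : (LinearMap.proj a : (ι → M) →ₗ[𝕜] M).comp (killRows Z) = 0 := by
    ext v
    simp [ha]
  rw [this, Submodule.map_zero]

theorem load_purge_of_ne {i₀ a : ι} (h : a ≠ i₀) : (s.purge i₀).load a = s.load a := by
  have h' : a ∉ ({i₀} : Finset ι) := by rwa [Finset.mem_singleton]
  show finrank 𝕜 ↥(Submodule.map (LinearMap.proj a : (ι → M) →ₗ[𝕜] M) (Submodule.map (killRows {i₀}) s.W)) = _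
  rw [map_proj_map_killRows _ h']
  rfl

theorem depth_purge_of_ne {i₀ a : ι} (h : a ≠ i₀) : (s.purge i₀).depth a = s.depth a := by
  by_cases haU : a ∈ s.U
  · have e1 : (s.purge i₀).depth a = (s.purge i₀).load a := by simp only [depth, purge_U, if_pos haU]
    have e2 : s.depth a = s.load a := by simp only [depth, if_pos haU]
    rw [e1, e2, load_purge_of_ne h]
  · have e1 : (s.purge i₀).depth a = finrank 𝕜 ↥((s.purge i₀).P a) := by simp only [depth, purge_U, if_neg haU]
    have e2 : s.depth a = finrank 𝕜 ↥(s.P a) := by simp only [depth, if_neg haU]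
    rw [e1, e2]
    rfl

/-- A purge of a dead row changes no potential of an undeclared alive row. -/
theorem row_step_purge {i₀ : ι} (hi : i₀ ∈ s.dead) {a : ι} (ha : a ∈ (s.purge i₀).ua) :
    2 * (s.purge i₀).K + (s.purge i₀).depth a + (s.purge i₀).gbar a + s.B
      ≤ 2 * s.K + s.depth a + s.gbar a + (s.purge i₀).B := by
  rw [purge_ua] at ha
  have hai : a ≠ i₀ := fun h => not_mem_dead_of_mem_ua ha (h ▸ hi)
  have hg : (s.purge i₀).gbar a = s.gbar a := by
    show finrank 𝕜 ↥(Submodule.map (killRows (s.purge i₀).dead) (Submodule.map (killRows {i₀}) s.W)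
        ⊓ rowSupp ((s.purge i₀).ua.erase a)) = finrank 𝕜 ↥(Submodule.map (killRows s.dead) s.W ⊓ rowSupp (s.ua.erase a))
    rw [purge_dead, purge_ua, map_killRows_map_killRows, ← Finset.insert_eq, Finset.insert_eq_of_mem hi]
  rw [hg, depth_purge_of_ne hai, purge_K, purge_B]

/-- (A)+(B) `row_step` of `BooksTrace` for one event. -/
theorem Step.row_step {s s' : BState 𝕜 ι M} (h : Step s s') :
    ∀ a ∈ s'.ua, 2 * s'.K + s'.depth a + s'.gbar a + s.B ≤ 2 * s.K + s.depth a + s.gbar a + s'.B := by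
  intro a ha
  cases h with
  | idle => exact le_rfl
  | bit x Q hQ hlt => exact row_step_bit x hQ ha
  | close i₀ Q hi hQ hlt => exact row_step_close hi hQ ha
  | purge i₀ hi => exact row_step_purge hi ha

/-- `UA` never grows. -/
theorem Step.ua_anti {s s' : BState 𝕜 ι M} (h : Step s s') : s'.ua ⊆ s.ua := by
  cases h with
  | idle => exact le_rfl
  | bit x Q hQ hlt => rw [bit_ua]; exact Finset.sdiff_subset
  | close i₀ Q hi hQ hlt => rw [close_ua]; exact Finset.sdiff_subset.trans (Finset.erase_subset _ _)
  | purge i₀ hi => rw [purge_ua]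

/-- declared alive rows stay declared and alive (kills hit undeclared rows only). -/
theorem Step.decl_persist {s s' : BState 𝕜 ι M} (h : Step s s') : s.A \ s.U ⊆ s'.A \ s'.U := by
  intro j hj
  obtain ⟨hjA, hjU⟩ := Finset.mem_sdiff.1 hj
  cases h with
  | idle => exact hj
  | bit x Q hQ hlt =>
    have hQU : Q ⊆ s.U := (hQ.trans (bitCand_sub x)).trans Finset.inter_subset_left
    exact Finset.mem_sdiff.2 ⟨Finset.mem_sdiff.2 ⟨hjA, fun h => hjU (hQU h)⟩, hjU⟩
  | close i₀ Q hi hQ hlt =>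
    have hQU : Q ⊆ s.U :=
      ((hQ.trans (closeCand_sub i₀)).trans (Finset.erase_subset _ _)).trans Finset.inter_subset_left
    exact Finset.mem_sdiff.2 ⟨Finset.mem_sdiff.2 ⟨hjA, fun h => hjU (hQU h)⟩,
      fun h => hjU (Finset.mem_of_mem_erase h)⟩
  | purge i₀ hi => exact hj

/-- (D) `last_row`: `UA` runs out only by closing its last row, an event without kills. -/
theorem Step.last_row {s s' : BState 𝕜 ι M} (h : Step s s') (hemp : s'.ua = ∅) (hne : s.ua.Nonempty) :
    ∃ u ∈ s.ua, u ∈ s'.A ∧ s'.K = s.K ∧ s'.depth u = s.depth u ∧ s.B ≤ s'.B := by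
  cases h with
  | idle => exact absurd hemp hne.ne_empty
  | bit x Q hQ hlt =>
    exfalso
    rw [bit_ua] at hemp
    have hsub : s.ua ⊆ Q := by
      intro j hj
      by_contra hjQ
      have : j ∈ s.ua \ Q := Finset.mem_sdiff.2 ⟨hj, hjQ⟩
      rw [hemp] at this
      simp at this
    have hQeq : Q = s.bitCand x := le_antisymm hQ ((bitCand_sub x).trans hsub)
    have hcne : (s.bitCand x).Nonempty := by
      rw [← hQeq]; exact hne.mono hsub
    exact hlt hcne hQeq
  | close i₀ Q hi hQ hlt =>
    rw [close_ua] at hemp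
    have hsub : s.ua.erase i₀ ⊆ Q := by
      intro j hj
      by_contra hjQ
      have : j ∈ (s.ua.erase i₀) \ Q := Finset.mem_sdiff.2 ⟨hj, hjQ⟩
      rw [hemp] at this
      simp at this
    have hQeq : Q = s.closeCand i₀ := le_antisymm hQ ((closeCand_sub i₀).trans hsub)
    have hce : s.closeCand i₀ = ∅ := by
      by_contra hne'
      exact hlt (Finset.nonempty_iff_ne_empty.2 hne') hQeq
    have hQe : Q = ∅ := by rw [hQeq, hce]
    subst hQe
    have herase : s.ua.erase i₀ = ∅ := Finset.subset_empty.1 hsub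
    -- so `UA = {i₀}`
    obtain ⟨u, hu⟩ := hne
    have hui : u = i₀ := by
      by_contra hne'
      have : u ∈ s.ua.erase i₀ := Finset.mem_erase.2 ⟨hne', hu⟩
      rw [herase] at this
      simp at this
    subst hui
    have huA : u ∈ s.A := (mem_ua.1 hu).2
    refine ⟨u, hu, ?_, by simp, ?_, le_rfl⟩
    · simpa using huA
    · have h1 : u ∉ s.U.erase u := by simp
      have e1 : (s.close u ∅).depth u = finrank 𝕜 ↥((s.close u ∅).P u) := by simp only [depth, close_U, if_neg h1]
      have e2 : s.depth u = s.load u := by simp only [depth, if_pos hi]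
      rw [e1, e2]
      show finrank 𝕜 ↥(Function.update s.P u (Submodule.map (LinearMap.proj u : (ι → M) →ₗ[𝕜] M) s.W) u)
        = finrank 𝕜 ↥(Submodule.map (LinearMap.proj u : (ι → M) →ₗ[𝕜] M) s.W)
      rw [Function.update_self]
  | purge i₀ hi =>
    rw [purge_ua] at hemp
    exact absurd hemp hne.ne_empty

/-- Once `UA = ∅`: no kills, and depths rise at most with the bits. -/
theorem Step.empty_step {s s' : BState 𝕜 ι M} (h : Step s s') (hemp : s.ua = ∅) :
    s'.K = s.K ∧ s.B ≤ s'.B ∧ ∀ a ∈ s'.A, s'.depth a + s.B ≤ s.depth a + s'.B := by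
  cases h with
  | idle => exact ⟨rfl, le_rfl, fun a _ => le_rfl⟩
  | bit x Q hQ hlt =>
    have hQe : Q = ∅ := Finset.subset_empty.1 (by rw [← hemp]; exact hQ.trans (bitCand_sub x))
    subst hQe
    refine ⟨by simp, by simp, fun a ha => ?_⟩
    have haA : a ∈ s.A := by simpa using ha
    have haU : a ∉ s.U := fun h => by
      have : a ∈ s.ua := mem_ua.2 ⟨h, haA⟩
      rw [hemp] at this; simp at this
    have e1 : (s.bit x ∅).depth a = finrank 𝕜 ↥(s.P a ⊔ 𝕜 ∙ x a) := by
      simp only [depth, bit_U, if_neg haU]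
      rfl
    have e2 : s.depth a = finrank 𝕜 ↥(s.P a) := by simp only [depth, if_neg haU]
    rw [e1, e2, bit_B]
    have h1 := finrank_sup_span_inf_le (s.P a) ⊤ (x a)
    rw [inf_top_eq, inf_top_eq] at h1
    omega
  | close i₀ Q hi hQ hlt =>
    have hQe : Q = ∅ := Finset.subset_empty.1 (by
      have := (hQ.trans (closeCand_sub i₀)).trans (Finset.erase_subset _ _)
      rwa [hemp] at this)
    subst hQe
    refine ⟨by simp, le_rfl, fun a ha => ?_⟩
    have haA : a ∈ s.A := by simpa using ha
    have haU : a ∉ s.U := fun h => by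
      have : a ∈ s.ua := mem_ua.2 ⟨h, haA⟩
      rw [hemp] at this; simp at this
    have hai : a ≠ i₀ := fun h => haU (h ▸ hi)
    have haU' : a ∉ s.U.erase i₀ := fun h => haU (Finset.mem_of_mem_erase h)
    have e1 : (s.close i₀ ∅).depth a = finrank 𝕜 ↥((s.close i₀ ∅).P a) := by
      simp only [depth, close_U, if_neg haU']
    have e2 : s.depth a = finrank 𝕜 ↥(s.P a) := by simp only [depth, if_neg haU]
    rw [e1, e2]
    show finrank 𝕜 ↥(Function.update s.P i₀ (Submodule.map (LinearMap.proj i₀ : (ι → M) →ₗ[𝕜] M) s.W) a) + s.B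
      ≤ finrank 𝕜 ↥(s.P a) + s.B
    rw [Function.update_of_ne hai]
  | purge i₀ hi =>
    refine ⟨rfl, le_rfl, fun a ha => ?_⟩
    have haA : a ∈ s.A := ha
    have hai : a ≠ i₀ := fun h => (mem_dead.1 hi).2 (h ▸ haA)
    rw [depth_purge_of_ne hai]
    exact le_rfl

/-- The bookkeeping invariants: alive rows never run out, at most one declared alive row per closure, depths count
fresh bits. -/
structure Inv (s : BState 𝕜 ι M) : Prop where
  alive_nonempty : s.A.Nonempty
  card_decl : (s.A \ s.U).card ≤ s.c
  load_le : ∀ a ∈ s.U, s.load a ≤ s.B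
  pin_le : ∀ a ∉ s.U, finrank 𝕜 ↥(s.P a) ≤ s.B

theorem Inv.init [Nonempty ι] : Inv (BState.init 𝕜 ι M) where
  alive_nonempty := Finset.univ_nonempty
  card_decl := by simp [BState.init]
  load_le := fun a _ => by
    show finrank 𝕜 ↥(Submodule.map (LinearMap.proj a : (ι → M) →ₗ[𝕜] M) (⊥ : Submodule 𝕜 (ι → M))) ≤ 0
    rw [Submodule.map_bot, finrank_bot]
  pin_le := fun a ha => by simp [BState.init] at ha

theorem Inv.step {s s' : BState 𝕜 ι M} (hs : Inv s) (h : Step s s') : Inv s' := by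
  cases h with
  | idle => exact hs
  | bit x Q hQ hlt =>
    have hQua : Q ⊆ s.ua := hQ.trans (bitCand_sub x)
    refine ⟨?_, ?_, ?_, ?_⟩
    · -- a bit never kills all candidates
      by_cases hc : (s.bitCand x).Nonempty
      · have hQne : Q ≠ s.bitCand x := hlt hc
        obtain ⟨j, hj, hjQ⟩ := Finset.exists_of_ssubset (lt_of_le_of_ne hQ hQne)
        exact ⟨j, by simpa using And.intro (mem_ua.1 (bitCand_sub x hj)).2 hjQ⟩
      · have hQe : Q = ∅ := Finset.subset_empty.1 (by rwa [Finset.not_nonempty_iff_eq_empty.1 hc] at hQ)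
        subst hQe
        simpa using hs.alive_nonempty
    · have hsub : (s.bit x Q).A \ (s.bit x Q).U ⊆ s.A \ s.U := by
        intro j hj
        simp only [bit_A, bit_U, Finset.mem_sdiff] at hj ⊢
        exact ⟨hj.1.1, hj.2⟩
      exact (Finset.card_le_card hsub).trans (by simpa using hs.card_decl)
    · intro a haU
      show finrank 𝕜 ↥(Submodule.map (LinearMap.proj a : (ι → M) →ₗ[𝕜] M) (s.W ⊔ 𝕜 ∙ s.rem x)) ≤ s.B + 1
      rw [map_proj_sup_span]
      have h1 := finrank_sup_span_inf_le (Submodule.map (LinearMap.proj a : (ι → M) →ₗ[𝕜] M) s.W) ⊤ (s.rem x a)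
      rw [inf_top_eq, inf_top_eq] at h1
      have h2 : finrank 𝕜 ↥(Submodule.map (LinearMap.proj a : (ι → M) →ₗ[𝕜] M) s.W) ≤ s.B := hs.load_le a haU
      omega
    · intro a haU
      show finrank 𝕜 ↥(s.P a ⊔ 𝕜 ∙ x a) ≤ s.B + 1
      have h1 := finrank_sup_span_inf_le (s.P a) ⊤ (x a)
      rw [inf_top_eq, inf_top_eq] at h1
      have h2 : finrank 𝕜 ↥(s.P a) ≤ s.B := hs.pin_le a haU
      omega
  | close i₀ Q hi hQ hlt =>
    have hQe : Q ⊆ s.ua.erase i₀ := hQ.trans (closeCand_sub i₀)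
    refine ⟨?_, ?_, ?_, ?_⟩
    · by_cases hiA : i₀ ∈ s.A
      · refine ⟨i₀, ?_⟩
        have : i₀ ∉ Q := fun h => by simpa using (Finset.mem_erase.1 (hQe h)).1
        simpa using And.intro hiA this
      · by_cases hc : (s.closeCand i₀).Nonempty
        · obtain ⟨j, hj, hjQ⟩ := Finset.exists_of_ssubset (lt_of_le_of_ne hQ (hlt hc))
          have hjA : j ∈ s.A := (mem_ua.1 (Finset.mem_of_mem_erase (closeCand_sub i₀ hj))).2
          exact ⟨j, by simpa using And.intro hjA hjQ⟩
        · have hQ0 : Q = ∅ := Finset.subset_empty.1 (by rwa [Finset.not_nonempty_iff_eq_empty.1 hc] at hQ)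
          subst hQ0
          simpa using hs.alive_nonempty
    · have hsub : (s.close i₀ Q).A \ (s.close i₀ Q).U ⊆ insert i₀ (s.A \ s.U) := by
        intro j hj
        rw [Finset.mem_sdiff, close_A, close_U, Finset.mem_sdiff, Finset.mem_erase] at hj
        rw [Finset.mem_insert, Finset.mem_sdiff]
        by_cases hji : j = i₀
        · exact Or.inl hji
        · exact Or.inr ⟨hj.1.1, fun hjU => hj.2 ⟨hji, hjU⟩⟩
      rw [close_c]
      calc ((s.close i₀ Q).A \ (s.close i₀ Q).U).card ≤ (insert i₀ (s.A \ s.U)).card := Finset.card_le_card hsub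
        _ ≤ (s.A \ s.U).card + 1 := Finset.card_insert_le _ _
        _ ≤ s.c + 1 := by have := hs.card_decl; omega
    · intro a haU
      obtain ⟨hai, haU0⟩ := Finset.mem_erase.1 haU
      have hai' : a ∉ ({i₀} : Finset ι) := by rwa [Finset.mem_singleton]
      show finrank 𝕜 ↥(Submodule.map (LinearMap.proj a : (ι → M) →ₗ[𝕜] M) (Submodule.map (killRows {i₀}) s.W)) ≤ s.B
      rw [map_proj_map_killRows _ hai']
      exact hs.load_le a haU0
    · intro a haU
      rw [close_U, Finset.mem_erase] at haU
      by_cases hai : a = i₀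
      · subst hai
        show finrank 𝕜 ↥(Function.update s.P a (Submodule.map (LinearMap.proj a : (ι → M) →ₗ[𝕜] M) s.W) a) ≤ s.B
        rw [Function.update_self]
        exact hs.load_le a hi
      · show finrank 𝕜 ↥(Function.update s.P i₀ (Submodule.map (LinearMap.proj i₀ : (ι → M) →ₗ[𝕜] M) s.W) a) ≤ s.B
        rw [Function.update_of_ne hai]
        exact hs.pin_le a (fun h => haU ⟨hai, h⟩)
  | purge i₀ hi =>
    refine ⟨hs.alive_nonempty, hs.card_decl, ?_, hs.pin_le⟩
    intro a haU
    by_cases hai : a = i₀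
    · subst hai
      show finrank 𝕜 ↥(Submodule.map (LinearMap.proj a : (ι → M) →ₗ[𝕜] M) (Submodule.map (killRows {a}) s.W)) ≤ s.B
      rw [map_proj_map_killRows_of_mem _ (Finset.mem_singleton_self a), finrank_bot]
      exact Nat.zero_le _
    · rw [load_purge_of_ne hai]
      exact hs.load_le a haU

/-- A run of the books: states from `init`, each obtained from the previous one by one event (or a stutter). -/
structure Run where
  traj : ℕ → BState 𝕜 ι M
  start : traj 0 = BState.init 𝕜 ι M
  step : ∀ t, Step (traj t) (traj (t + 1))

namespace Run

variable [Nonempty ι] (r : Run (𝕜 := 𝕜) (ι := ι) (M := M))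

theorem inv : ∀ t, Inv (r.traj t)
  | 0 => by rw [r.start]; exact Inv.init
  | t + 1 => (inv t).step (r.step t)

/-- The observables of a run form a `BooksTrace` (§3): this discharges the hypotheses (A)–(D). -/
noncomputable def toTrace : BooksTrace ι where
  alive t := (r.traj t).A
  decl t := (r.traj t).A \ (r.traj t).U
  d t := (r.traj t).depth
  g t := (r.traj t).gbar
  K t := (r.traj t).K
  B t := (r.traj t).B
  c t := (r.traj t).c
  decl_sub t := Finset.sdiff_subset
  alive_nonempty t := (r.inv t).alive_nonempty
  card_decl t := (r.inv t).card_decl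
  depth_le_bits t a ha := by
    by_cases haU : a ∈ (r.traj t).U
    · simp only [depth, if_pos haU]
      exact (r.inv t).load_le a haU
    · simp only [depth, if_neg haU]
      exact (r.inv t).pin_le a haU
  init_K := by rw [r.start]; rfl
  init_d a := by
    rw [r.start]
    show (if a ∈ (Finset.univ : Finset ι) then
        finrank 𝕜 ↥(Submodule.map (LinearMap.proj a : (ι → M) →ₗ[𝕜] M) (⊥ : Submodule 𝕜 (ι → M)))
      else finrank 𝕜 ↥(⊥ : Submodule 𝕜 M)) = 0
    rw [if_pos (Finset.mem_univ a), Submodule.map_bot, finrank_bot]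
  init_g a := by
    rw [r.start]
    show finrank 𝕜 ↥(Submodule.map (killRows (BState.init 𝕜 ι M).dead) (⊥ : Submodule 𝕜 (ι → M))
      ⊓ rowSupp ((BState.init 𝕜 ι M).ua.erase a)) = 0
    rw [Submodule.map_bot, bot_inf_eq, finrank_bot]
  undecl_anti t := by
    simp only [alive_sdiff_decl]
    exact (r.step t).ua_anti
  decl_persist t := (r.step t).decl_persist
  row_step t a ha := by
    simp only [alive_sdiff_decl] at ha
    exact (r.step t).row_step a ha
  last_row t hemp hne := by
    simp only [alive_sdiff_decl] at hemp hne ⊢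
    exact (r.step t).last_row hemp hne
  empty_step t hemp := by
    simp only [alive_sdiff_decl] at hemp
    exact (r.step t).empty_step hemp

/-- **(J′) for the books**: along every run and at every time, `D ≤ #bits + 2·#closes − 2K`. -/
theorem jprime (t : ℕ) :
    TwoRetiredDepthLe (r.traj t).A (r.traj t).depth (((r.traj t).B : ℤ) + 2 * (r.traj t).c - 2 * (r.traj t).K) :=
  r.toTrace.jprime t

/-- **(BANK\*) with `C = 0` for the books**: for any spend `H ≤ K`, `H + D ≤ #events`. -/
theorem bankStar (t : ℕ) {H : ℕ} (hH : H ≤ (r.traj t).K) :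
    TwoRetiredDepthLe (r.traj t).A (r.traj t).depth (((r.traj t).B : ℤ) + (r.traj t).c - H) :=
  r.toTrace.bankStar t hH

/-- `K + D ≤ #events`. -/
theorem klin (t : ℕ) :
    TwoRetiredDepthLe (r.traj t).A (r.traj t).depth (((r.traj t).B : ℤ) + (r.traj t).c - (r.traj t).K) :=
  r.toTrace.klin t

/-- Credit form: `M* ≥ H − #events − 1` at every prefix of every run. -/
theorem retiredFloorGe (t : ℕ) {H : ℕ} (hH : H ≤ (r.traj t).K) :
    RetiredFloorGe (r.traj t).A (fun i => -1 - ((r.traj t).depth i : ℤ)) ((H : ℤ) - ((r.traj t).B + (r.traj t).c) - 1) :=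
  r.toTrace.retiredFloorGe t hH

end Run

end BState

end Machine

end Summit.PneNP.PneNP.Cruxes.StrongComposition.P4g23X
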